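import Summits.BirchSwinnertonDyer.BirchSwinnertonDyer.Theorems.ManinLocalTwoThreeStevensShimuraKernelRational
import Summits.BirchSwinnertonDyer.BirchSwinnertonDyer.Theorems.ManinLocalTwoThreeStevensNaturalTes75
import Literature.NumberTheory.EllipticCurves.PeriodLatticeGamma1QuotientProofs
import HarnessLib

/-!
# The Shimura exponent is a Mazur order: `kΛ₀(f) ⊆ Λ₁(f)` for some `k ∈ {1,…,10,12}` (⟸ Mazur's torsion theorem alone),
# and `Λ₀(f)/Λ₁(f) ≅ ℤ/n` with `n ∈ {1,…,10,12}`, generated by a RATIONAL point of Stevens' twin (⟸ Mazur ∧ modularity)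
(route `ManinLocalTwoThree`, crux C2 `ManinOddAtFour` stmt-BirchSwinnertonDyer-22967; cell bsd-f2-manin, prover seat p3 gen 21;
`--supports stmt-BirchSwinnertonDyer-22967`; es g41 §63 exponent programme E-es-193/194, currency `∀ z ∈ Λ₀(f), k·z ∈ Λ₁(f)`)

For every `X₀(N)`-datum `D₀` of an elliptic `W₀/ℚ` with newform `f`, the Shimura-cover kernel `Λ₀(f)/Λ₁(f)` (`Λ₀ = periodLattice f`,
`Λ₁ = periodLatticeGamma1 f`) EMBEDS into the rational torsion of Stevens' `X₁(N)`-twin `W₁` (p2 g23's THEOREM K constancy half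
`CuspValues.shimuraKernelRational`: an `X₁(N)`-datum `D₁` of `W₁` with `D₁.f = f`, `Λ(D₁.L) = Λ₁(f)` and `π₁(z) ∈ W₁(ℚ)` for all `z ∈ Λ₀(f)`).
Hence:

* §1 pure group theory of Mazur's fifteen groups: a common exponent `k ∈ {1,…,10,12}` (`exists_nsmul_eq_zero_of_mazurShape`), every element
  order is a Mazur order (`addOrderOf_mazurOrder_of_mazurShape`), `k ∣ 2520`.
* §2 transport along the twin: `k • P = 0 ↔ k·z ∈ Λ₁(f)` for a rational `P` over `π₁(z)`; finiteness of the order (`φ(N)Λ₀ ⊆ Λ₁`).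
* §3 **`exists_mazurOrder_mul_mem_periodLatticeGamma1`** — ⟸ `mazur_torsion` ALONE (no modularity, no CES, no Stevens binder):
  `∃ k, 1 ≤ k ∧ (k ≤ 10 ∨ k = 12) ∧ kΛ₀(f) ⊆ Λ₁(f)`; uniform corollary `2520·Λ₀(f) ⊆ Λ₁(f)`; pointwise every `z ∈ Λ₀(f)` has a Mazur
  order modulo `Λ₁(f)`.
* §4 **`exists_ratPoint_generator_of_modularity`** — ⟸ modularity alone (LEAD's `StevensGalois.shimuraKernelCyclic_of_modularity`, p767029):
  the kernel of Stevens' covering `W₁ → W₀` is `⟨P⟩` for ONE RATIONAL point `P ∈ W₁(ℚ)` of finite order `n`, with `Λ₀(f) = ℤz₀ + Λ₁(f)`,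
  `π₁(z₀) = P` and `k·z₀ ∈ Λ₁(f) ↔ n ∣ k` — so `n = [Λ₀(f) : Λ₁(f)]` (`relIndex_eq_addOrderOf`), Vatsal's `K′ ≅ ker θ` currency.
* §5 **`exists_generator_mazurOrder_of_modularity`** — ⟸ {`mazur_torsion`, modularity}: `Λ₀(f)/Λ₁(f) ≅ ℤ/n` with `n ∈ {1,…,10,12}`
  (`1 ≤ n`, `n ≤ 10 ∨ n = 12`), and `[Λ₀(f) : Λ₁(f)] ∈ {1,…,10,12}` (`relIndex_mazurOrder_of_modularity`).

Print (as reported by es MEMO-es §63): `#(E₀ ∩ Σ(N)) ≤ 16`; es's paper THEOREM S (MEMO-es §63) asserts `{1,…,6}` modulo further printed facts; the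
tree already has `ℓ ≥ 11 ⟹ ℓ ∤ [Λ₀ : Λ₁]` modulo Mazur by the Katz road (LEAD g9 `shimuraIndexPrimeTo_of_eleven_le'`, not re-derived here).

HONEST FRAMING: §1, §2, §4 are unconditional (§4 takes `exists_isNewformOf` = modularity as a binder); §3 and §5 are CONDITIONAL on the
statement-only printed fact `mazur_torsion` (Mazur 1977 Thm. 8).  Nothing here narrows C2/C3; Manin's conjecture and BSD are NOT proved.
No definitions, no sorry.
[cite: Mazur1977, Thm. (8)] [cite: Stevens1989, §2 (1.4), (2.8)] [cite: Vatsal2005, Rem. 1.8] [cite: LingOesterle1991, §1]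
-/

set_option autoImplicit false
-- lint-debt: the directory name repeats the summit name (sibling precedent `ManinLocalTwoThreeStevensCurveConsumers.lean`)
set_option linter.dupNamespace false

noncomputable section

open CongruenceSubgroup WeierstrassCurve
open Literature.NumberTheory.EllipticCurves Literature.NumberTheory.EllipticCurves.ModularForms
open Summit.BirchSwinnertonDyer.Rank1Residual.ManinAdditive

namespace Summit.BirchSwinnertonDyer.BirchSwinnertonDyer.Theorems.ManinLocalTwoThree.StevensCurve

/-! ## §1 Mazur's fifteen groups: exponent and element orders -/

/-- **A common exponent of a Mazur-shaped group is a Mazur order.**  If the torsion subgroup of `G` is `ℤ/n` (`1 ≤ n ≤ 10` or `n = 12`) or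
`ℤ/2 × ℤ/2m` (`1 ≤ m ≤ 4`), then some `k` with `1 ≤ k ≤ 10` or `k = 12` kills every element of finite order (`k = n`, resp. `k = 2m`).
[cite: Mazur1977, Thm. (8)] -/
theorem exists_nsmul_eq_zero_of_mazurShape {G : Type*} [AddCommGroup G]
    (hM : (∃ n : ℕ, 1 ≤ n ∧ (n ≤ 10 ∨ n = 12) ∧ Nonempty (AddCommGroup.torsion G ≃+ ZMod n)) ∨
      (∃ m : ℕ, 1 ≤ m ∧ m ≤ 4 ∧ Nonempty (AddCommGroup.torsion G ≃+ ZMod 2 × ZMod (2 * m)))) :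
    ∃ k : ℕ, 1 ≤ k ∧ (k ≤ 10 ∨ k = 12) ∧ ∀ P : G, IsOfFinAddOrder P → k • P = 0 := by
  have key : ∀ (k : ℕ) (P : G) (hP : P ∈ AddCommGroup.torsion G),
      k • (⟨P, hP⟩ : AddCommGroup.torsion G) = 0 → k • P = 0 := fun k P hP h ↦ by
    simpa using congrArg Subtype.val h
  rcases hM with ⟨n, hn, hn', ⟨e⟩⟩ | ⟨m, hm, hm4, ⟨e⟩⟩
  · refine ⟨n, hn, hn', fun P hP ↦ key n P ((AddCommGroup.mem_torsion P).mpr hP) (e.injective ?_)⟩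
    rw [map_nsmul, map_zero, nsmul_eq_mul, ZMod.natCast_self, zero_mul]
  · refine ⟨2 * m, by omega, Or.inl (by omega), fun P hP ↦
      key (2 * m) P ((AddCommGroup.mem_torsion P).mpr hP) (e.injective ?_)⟩
    rw [map_nsmul, map_zero]
    refine Prod.ext ?_ ?_
    · rw [Prod.smul_fst, Prod.fst_zero, nsmul_eq_mul, Nat.cast_mul, ZMod.natCast_self, zero_mul, zero_mul]
    · rw [Prod.smul_snd, Prod.snd_zero, nsmul_eq_mul, ZMod.natCast_self, zero_mul]

/-- Divisors of Mazur orders are Mazur orders (`n ∣ k`, `k ∈ {1,…,10,12}` ⟹ `n ∈ {1,…,10,12}`). [folklore] -/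
theorem mazurOrder_of_dvd {n k : ℕ} (hk : 1 ≤ k) (hk' : k ≤ 10 ∨ k = 12) (h : n ∣ k) : 1 ≤ n ∧ (n ≤ 10 ∨ n = 12) := by
  have hn : n ≤ k := Nat.le_of_dvd (by omega) h
  have hn0 : n ≠ 0 := by
    rintro rfl
    rw [zero_dvd_iff] at h
    omega
  rcases hk' with hk' | rfl
  · omega
  · have h11 : n ≠ 11 := by
      rintro rfl
      revert h
      decide
    omega

/-- Mazur orders divide `2520 = lcm(1,…,10,12)`. [folklore] -/
theorem dvd_2520_of_mazurOrder {k : ℕ} (hk : 1 ≤ k) (hk' : k ≤ 10 ∨ k = 12) : k ∣ 2520 := by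
  rcases hk' with hk' | rfl
  · interval_cases k <;> norm_num
  · norm_num

/-- **Every element of finite order of a Mazur-shaped group has a Mazur order** (`1 ≤ ord P ≤ 10` or `ord P = 12`). [cite: Mazur1977, Thm. (8)] -/
theorem addOrderOf_mazurOrder_of_mazurShape {G : Type*} [AddCommGroup G]
    (hM : (∃ n : ℕ, 1 ≤ n ∧ (n ≤ 10 ∨ n = 12) ∧ Nonempty (AddCommGroup.torsion G ≃+ ZMod n)) ∨
      (∃ m : ℕ, 1 ≤ m ∧ m ≤ 4 ∧ Nonempty (AddCommGroup.torsion G ≃+ ZMod 2 × ZMod (2 * m))))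
    (P : G) (hP : IsOfFinAddOrder P) : 1 ≤ addOrderOf P ∧ (addOrderOf P ≤ 10 ∨ addOrderOf P = 12) := by
  obtain ⟨k, hk, hk', hkill⟩ := exists_nsmul_eq_zero_of_mazurShape hM
  exact mazurOrder_of_dvd hk hk' (addOrderOf_dvd_iff_nsmul_eq_zero.mpr (hkill P hP))

/-! ## §2 Transport along Stevens' twin: orders of rational points over `Γ₀(N)`-periods -/

variable {N : ℕ} [NeZero N]

/-- `π₁(w) = 0 ↔ w ∈ Λ₁(f)` for an `X₁(N)`-datum whose Néron lattice is `Λ₁(f)` (es g41d's `uniformize_eq_zero_iff_mem`, kernel-checked). -/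
theorem uniformize_eq_zero_iff_of_latticeEq {W₁ : WeierstrassCurve ℚ} [W₁.IsElliptic] (D₁ : Gamma1ParametrizationData W₁ N)
    {f : CuspForm (Gamma0 N) 2} (hL : ∀ x, x ∈ D₁.L.lattice ↔ x ∈ periodLatticeGamma1 f) (w : ℂ) :
    D₁.uniformize w = 0 ↔ w ∈ periodLatticeGamma1 f := by
  rw [← hL w, ← AddMonoidHom.mem_ker, ← SetLike.mem_coe, D₁.ker_uniformize]
  rfl

/-- **Order transport**: if the rational point `P` base-changes to `π₁(z)` and `Λ(D₁.L) = Λ₁(f)`, then `k • P = 0 ↔ k·z ∈ Λ₁(f)`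
(injectivity of `W₁(ℚ) → W₁(ℂ)`). [cite: Stevens1989, §2 (1.4)] -/
theorem nsmul_eq_zero_iff_of_baseChange_eq {W₁ : WeierstrassCurve ℚ} [W₁.IsElliptic] (D₁ : Gamma1ParametrizationData W₁ N)
    {f : CuspForm (Gamma0 N) 2} (hL : ∀ x, x ∈ D₁.L.lattice ↔ x ∈ periodLatticeGamma1 f) {z : ℂ}
    {P : (W₁.baseChange ℚ).toAffine.Point} (hP : Affine.Point.baseChange (W' := W₁) ℚ ℂ P = D₁.uniformize z) (k : ℕ) :
    k • P = 0 ↔ (k : ℂ) * z ∈ periodLatticeGamma1 f := by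
  have hinj : Function.Injective (Affine.Point.baseChange (W' := W₁) ℚ ℂ) :=
    Affine.Point.map_injective (W' := W₁) (Algebra.ofId ℚ ℂ)
  rw [← uniformize_eq_zero_iff_of_latticeEq D₁ hL, ← nsmul_eq_mul, map_nsmul, ← hP, ← map_nsmul,
    ← map_zero (Affine.Point.baseChange (W' := W₁) ℚ ℂ)]
  exact ⟨fun h ↦ by rw [h], fun h ↦ hinj h⟩

/-- Integer version of the order transport: `k • P = 0 ↔ k·z ∈ Λ₁(f)` for `k : ℤ`. [cite: Stevens1989, §2 (1.4)] -/
theorem zsmul_eq_zero_iff_of_baseChange_eq {W₁ : WeierstrassCurve ℚ} [W₁.IsElliptic] (D₁ : Gamma1ParametrizationData W₁ N)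
    {f : CuspForm (Gamma0 N) 2} (hL : ∀ x, x ∈ D₁.L.lattice ↔ x ∈ periodLatticeGamma1 f) {z : ℂ}
    {P : (W₁.baseChange ℚ).toAffine.Point} (hP : Affine.Point.baseChange (W' := W₁) ℚ ℂ P = D₁.uniformize z) (k : ℤ) :
    k • P = 0 ↔ (k : ℂ) * z ∈ periodLatticeGamma1 f := by
  have hinj : Function.Injective (Affine.Point.baseChange (W' := W₁) ℚ ℂ) :=
    Affine.Point.map_injective (W' := W₁) (Algebra.ofId ℚ ℂ)
  rw [← uniformize_eq_zero_iff_of_latticeEq D₁ hL, ← zsmul_eq_mul, map_zsmul, ← hP, ← map_zsmul,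
    ← map_zero (Affine.Point.baseChange (W' := W₁) ℚ ℂ)]
  exact ⟨fun h ↦ by rw [h], fun h ↦ hinj h⟩

/-- **Finite order**: a rational point over a `Γ₀(N)`-period `z ∈ Λ₀(f)` is torsion, since `φ(N)·z ∈ Λ₁(f)`
(`totient_mul_mem_periodLatticeGamma1`). [cite: LingOesterle1991, §1] -/
theorem isOfFinAddOrder_of_baseChange_eq {W₁ : WeierstrassCurve ℚ} [W₁.IsElliptic] (D₁ : Gamma1ParametrizationData W₁ N)
    {f : CuspForm (Gamma0 N) 2} (hL : ∀ x, x ∈ D₁.L.lattice ↔ x ∈ periodLatticeGamma1 f) {z : ℂ} (hz : z ∈ periodLattice f)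
    {P : (W₁.baseChange ℚ).toAffine.Point} (hP : Affine.Point.baseChange (W' := W₁) ℚ ℂ P = D₁.uniformize z) :
    IsOfFinAddOrder P :=
  isOfFinAddOrder_iff_nsmul_eq_zero.mpr ⟨Nat.totient N, Nat.totient_pos.mpr (NeZero.pos N),
    (nsmul_eq_zero_iff_of_baseChange_eq D₁ hL hP _).mpr (totient_mul_mem_periodLatticeGamma1 f hz)⟩

/-! ## §3 ⟸ Mazur's torsion theorem ALONE: the Shimura exponent is a Mazur order -/

/-- **THE SHIMURA EXPONENT IS A MAZUR ORDER (⟸ `mazur_torsion` alone).**  For every `X₀(N)`-datum `D₀` of an elliptic `W₀/ℚ` there is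
`k` with `1 ≤ k ≤ 10` or `k = 12` such that `k·Λ₀(f) ⊆ Λ₁(f)` (`f = D₀.f`): `Λ₀(f)/Λ₁(f)` embeds into `W₁(ℚ)_tors` of Stevens' twin
(p2's `CuspValues.shimuraKernelRational`), a Mazur group of exponent `k`.  CONDITIONAL on `mazur_torsion`; no modularity, no CES, no
Stevens binder. [cite: Mazur1977, Thm. (8)] [cite: Stevens1989, §2 (1.4), (2.8)] [cite: Vatsal2005, Rem. 1.8] -/
theorem exists_mazurOrder_mul_mem_periodLatticeGamma1 (hMT : ∀ V : WeierstrassCurve ℚ, mazur_torsion V)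
    (W₀ : WeierstrassCurve ℚ) [W₀.IsElliptic] (D₀ : ModularParametrizationData W₀ N) :
    ∃ k : ℕ, 1 ≤ k ∧ (k ≤ 10 ∨ k = 12) ∧ ∀ z ∈ periodLattice D₀.f, (k : ℂ) * z ∈ periodLatticeGamma1 D₀.f := by
  obtain ⟨W₁, hW₁, D₁, -, hL, hrat⟩ := CuspValues.shimuraKernelRational W₀ D₀
  obtain ⟨k, hk, hk', hkill⟩ := exists_nsmul_eq_zero_of_mazurShape (hMT (W₁.baseChange ℚ))
  refine ⟨k, hk, hk', fun z hz ↦ ?_⟩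
  obtain ⟨P, hP⟩ := hrat z hz
  exact (nsmul_eq_zero_iff_of_baseChange_eq D₁ hL hP k).mp (hkill P (isOfFinAddOrder_of_baseChange_eq D₁ hL hz hP))

/-- **Uniform corollary: `2520·Λ₀(f) ⊆ Λ₁(f)` for every elliptic newform with an `X₀(N)`-datum** (⟸ `mazur_torsion`).
[cite: Mazur1977, Thm. (8)] -/
theorem mul_2520_mem_periodLatticeGamma1 (hMT : ∀ V : WeierstrassCurve ℚ, mazur_torsion V)
    (W₀ : WeierstrassCurve ℚ) [W₀.IsElliptic] (D₀ : ModularParametrizationData W₀ N)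
    {z : ℂ} (hz : z ∈ periodLattice D₀.f) : (2520 : ℂ) * z ∈ periodLatticeGamma1 D₀.f := by
  obtain ⟨k, hk, hk', hkΛ⟩ := exists_mazurOrder_mul_mem_periodLatticeGamma1 hMT W₀ D₀
  obtain ⟨q, hq⟩ := dvd_2520_of_mazurOrder hk hk'
  have h : (2520 : ℂ) * z = (q : ℂ) * ((k : ℂ) * z) := by
    rw [← mul_assoc, ← Nat.cast_mul, mul_comm q, ← hq]; norm_num
  rw [h, ← nsmul_eq_mul]
  exact AddSubgroup.nsmul_mem _ (hkΛ z hz) q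

/-- **Pointwise: every `Γ₀(N)`-period has a Mazur order modulo `Λ₁(f)`** (⟸ `mazur_torsion`): for `z ∈ Λ₀(f)` there is `n` with
`1 ≤ n ≤ 10` or `n = 12` and `k·z ∈ Λ₁(f) ↔ n ∣ k`. [cite: Mazur1977, Thm. (8)] [cite: Stevens1989, §2 (1.4)] -/
theorem exists_mazurOrder_mul_mem_iff_dvd (hMT : ∀ V : WeierstrassCurve ℚ, mazur_torsion V)
    (W₀ : WeierstrassCurve ℚ) [W₀.IsElliptic] (D₀ : ModularParametrizationData W₀ N) {z : ℂ} (hz : z ∈ periodLattice D₀.f) :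
    ∃ n : ℕ, 1 ≤ n ∧ (n ≤ 10 ∨ n = 12) ∧ ∀ k : ℕ, (k : ℂ) * z ∈ periodLatticeGamma1 D₀.f ↔ n ∣ k := by
  obtain ⟨W₁, hW₁, D₁, -, hL, hrat⟩ := CuspValues.shimuraKernelRational W₀ D₀
  obtain ⟨P, hP⟩ := hrat z hz
  have hfin : IsOfFinAddOrder P := isOfFinAddOrder_of_baseChange_eq D₁ hL hz hP
  obtain ⟨h1, h2⟩ := addOrderOf_mazurOrder_of_mazurShape (hMT (W₁.baseChange ℚ)) P hfin
  exact ⟨addOrderOf P, h1, h2, fun k ↦ by rw [← nsmul_eq_zero_iff_of_baseChange_eq D₁ hL hP k, addOrderOf_dvd_iff_nsmul_eq_zero]⟩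

/-! ## §4 ⟸ modularity alone: the kernel of Stevens' covering is generated by ONE rational point -/

/-- **The Shimura kernel is `⟨P⟩` for a RATIONAL point `P` of Stevens' twin (⟸ modularity).**  For every `X₀(N)`-datum `D₀` of an elliptic
`W₀/ℚ` (`f = D₀.f`) there are an elliptic `W₁/ℚ`, an OPTIMAL `X₁(N)`-datum `D₁` of `W₁` with `D₁.f = f`, `D₁.c = 1`, `Λ(D₁.L) = Λ₁(f)`, a
period `z₀ ∈ Λ₀(f)` and a rational point `P ∈ W₁(ℚ)` of finite order `n = ord P` with: `π₁(z₀) = P`, `Λ₀(f) = ℤz₀ + Λ₁(f)` (LEAD's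
cyclicity `StevensGalois.shimuraKernelCyclic_of_modularity`), `k·z₀ ∈ Λ₁(f) ↔ n ∣ k`, and `π₁(Λ₀(f)) = ℤ·P` — Vatsal's `K′ = Λ₀/Λ₁ ≅ ker θ`.
CONDITIONAL on `exists_isNewformOf` (modularity, consumed by the cyclicity theorem only).
[cite: Stevens1989, §2 (1.4), (2.8)] [cite: Vatsal2005, Rem. 1.8] [cite: Mazur1977, §II.11] -/
theorem exists_ratPoint_generator_of_modularity (hnf : exists_isNewformOf)
    (W₀ : WeierstrassCurve ℚ) [W₀.IsElliptic] (D₀ : ModularParametrizationData W₀ N) :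
    ∃ (W₁ : WeierstrassCurve ℚ) (_ : W₁.IsElliptic) (D₁ : Gamma1ParametrizationData W₁ N),
      D₁.f = D₀.f ∧ D₁.c = 1 ∧ D₁.IsOptimal ∧ (∀ x, x ∈ D₁.L.lattice ↔ x ∈ periodLatticeGamma1 D₀.f) ∧
      ∃ (z₀ : ℂ) (P : (W₁.baseChange ℚ).toAffine.Point), z₀ ∈ periodLattice D₀.f ∧
        Affine.Point.baseChange (W' := W₁) ℚ ℂ P = D₁.uniformize z₀ ∧ 0 < addOrderOf P ∧
        (∀ z ∈ periodLattice D₀.f, ∃ (k : ℤ) (w : ℂ), w ∈ periodLatticeGamma1 D₀.f ∧ z = (k : ℂ) * z₀ + w) ∧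
        (∀ k : ℕ, (k : ℂ) * z₀ ∈ periodLatticeGamma1 D₀.f ↔ addOrderOf P ∣ k) ∧
        ∀ z ∈ periodLattice D₀.f, ∃ k : ℤ, D₁.uniformize z = Affine.Point.baseChange (W' := W₁) ℚ ℂ (k • P) := by
  obtain ⟨W₁, hW₁, D₁, hf, hc, hopt, hL, -⟩ := CuspValues.exists_optimal_gamma1ParametrizationData_flat_of_datum D₀
  obtain ⟨z₀, hz₀, hgen⟩ := StevensGalois.shimuraKernelCyclic_of_modularity hnf W₀ D₀
  obtain ⟨P, hP⟩ := CuspValues.exists_ratPoint_eq_uniformize_of_mem_periodLattice D₁ hc z₀ (by rw [hf]; exact hz₀)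
  have hfin : IsOfFinAddOrder P := isOfFinAddOrder_of_baseChange_eq D₁ hL hz₀ hP
  refine ⟨W₁, hW₁, D₁, hf, hc, hopt, hL, z₀, P, hz₀, hP, hfin.addOrderOf_pos, hgen, fun k ↦ ?_, fun z hz ↦ ?_⟩
  · rw [← nsmul_eq_zero_iff_of_baseChange_eq D₁ hL hP k, addOrderOf_dvd_iff_nsmul_eq_zero]
  · obtain ⟨k, w, hw, rfl⟩ := hgen z hz
    refine ⟨k, ?_⟩
    rw [map_add, (uniformize_eq_zero_iff_of_latticeEq D₁ hL w).mpr hw, add_zero, ← zsmul_eq_mul, map_zsmul, map_zsmul, hP]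

/-- **The Shimura index is the order of the rational generator**: with `z₀`, `n` as above (`Λ₀(f) = ℤz₀ + Λ₁(f)`, `k·z₀ ∈ Λ₁(f) ↔ n ∣ k`),
`[Λ₀(f) : Λ₁(f)] = n` (`AddSubgroup.relIndex`). Pure lattice algebra. [folklore] -/
theorem relIndex_eq_of_generator {Λ₀ Λ₁ : AddSubgroup ℂ} {z₀ : ℂ} (hz₀ : z₀ ∈ Λ₀) {n : ℕ}
    (hgen : ∀ z ∈ Λ₀, ∃ (k : ℤ) (w : ℂ), w ∈ Λ₁ ∧ z = (k : ℂ) * z₀ + w)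
    (hord : ∀ k : ℕ, (k : ℂ) * z₀ ∈ Λ₁ ↔ n ∣ k) : Λ₁.relIndex Λ₀ = n := by
  classical
  -- the quotient `Λ₀ / (Λ₁ ∩ Λ₀)` is generated by the class of `z₀`
  set H : AddSubgroup Λ₀ := Λ₁.addSubgroupOf Λ₀ with hH
  set x : Λ₀ ⧸ H := QuotientAddGroup.mk ⟨z₀, hz₀⟩ with hx
  have htop : AddSubgroup.zmultiples x = ⊤ := by
    rw [AddSubgroup.eq_top_iff']
    intro q
    induction q using QuotientAddGroup.induction_on with
    | H z =>
      obtain ⟨k, w, hw, hzw⟩ := hgen z.1 z.2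
      rw [AddSubgroup.mem_zmultiples_iff]
      refine ⟨k, ?_⟩
      rw [hx, ← QuotientAddGroup.mk_zsmul, QuotientAddGroup.eq_iff_sub_mem, hH, AddSubgroup.mem_addSubgroupOf]
      have : ((k • (⟨z₀, hz₀⟩ : Λ₀) - z : Λ₀) : ℂ) = -w := by
        push_cast
        rw [hzw, zsmul_eq_mul]; ring
      rw [this]
      exact Λ₁.neg_mem hw
  have hordx : addOrderOf x = n := by
    have hiff : ∀ k : ℕ, k • x = 0 ↔ n ∣ k := fun k ↦ by
      rw [hx, ← QuotientAddGroup.mk_nsmul, QuotientAddGroup.eq_zero_iff, hH, AddSubgroup.mem_addSubgroupOf, ← hord k]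
      push_cast
      rw [nsmul_eq_mul]
    exact Nat.dvd_antisymm (addOrderOf_dvd_iff_nsmul_eq_zero.mpr ((hiff n).mpr dvd_rfl))
      ((hiff _).mp (addOrderOf_nsmul_eq_zero x))
  rw [AddSubgroup.relIndex, ← hH, AddSubgroup.index, ← AddSubgroup.card_top (G := Λ₀ ⧸ H), ← htop, Nat.card_zmultiples, hordx]

/-- **`[Λ₀(f) : Λ₁(f)]` is the order of a RATIONAL point of Stevens' twin (⟸ modularity)**: `∃ W₁, D₁ (c = 1, optimal, Λ(D₁.L) = Λ₁(f)),
P ∈ W₁(ℚ)` torsion with `(periodLatticeGamma1 f).relIndex (periodLattice f) = addOrderOf P`.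
[cite: Stevens1989, §2 (1.4), (2.8)] [cite: Vatsal2005, Rem. 1.8] -/
theorem relIndex_eq_addOrderOf_of_modularity (hnf : exists_isNewformOf)
    (W₀ : WeierstrassCurve ℚ) [W₀.IsElliptic] (D₀ : ModularParametrizationData W₀ N) :
    ∃ (W₁ : WeierstrassCurve ℚ) (_ : W₁.IsElliptic) (D₁ : Gamma1ParametrizationData W₁ N),
      D₁.f = D₀.f ∧ D₁.c = 1 ∧ D₁.IsOptimal ∧ (∀ x, x ∈ D₁.L.lattice ↔ x ∈ periodLatticeGamma1 D₀.f) ∧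
      ∃ P : (W₁.baseChange ℚ).toAffine.Point, 0 < addOrderOf P ∧
        (periodLatticeGamma1 D₀.f).relIndex (periodLattice D₀.f) = addOrderOf P ∧
        ∀ z ∈ periodLattice D₀.f, ∃ k : ℤ, D₁.uniformize z = Affine.Point.baseChange (W' := W₁) ℚ ℂ (k • P) := by
  obtain ⟨W₁, hW₁, D₁, hf, hc, hopt, hL, z₀, P, hz₀, hP, hpos, hgen, hord, hmult⟩ :=
    exists_ratPoint_generator_of_modularity hnf W₀ D₀
  exact ⟨W₁, hW₁, D₁, hf, hc, hopt, hL, P, hpos,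
    relIndex_eq_of_generator hz₀ hgen hord, hmult⟩

/-! ## §5 ⟸ {Mazur, modularity}: `Λ₀(f)/Λ₁(f) ≅ ℤ/n` with `n ∈ {1,…,10,12}` -/

/-- **`Λ₀(f)/Λ₁(f)` IS CYCLIC OF A MAZUR ORDER (⟸ {`mazur_torsion`, modularity}).**  For every `X₀(N)`-datum `D₀` (`f = D₀.f`) there are
`n` with `1 ≤ n ≤ 10` or `n = 12` and `z₀ ∈ Λ₀(f)` with `Λ₀(f) = ℤz₀ + Λ₁(f)` and `k·z₀ ∈ Λ₁(f) ↔ n ∣ k` — i.e. `Λ₀(f)/Λ₁(f) ≅ ℤ/n`,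
`n = #(E₀ ∩ Σ(N)) ∈ {1,…,10,12}` (print: `≤ 16`).  CONDITIONAL on `mazur_torsion` and `exists_isNewformOf`.
[cite: Mazur1977, Thm. (8)] [cite: Stevens1989, §2] [cite: Vatsal2005, Rem. 1.8] -/
theorem exists_generator_mazurOrder_of_modularity (hnf : exists_isNewformOf) (hMT : ∀ V : WeierstrassCurve ℚ, mazur_torsion V)
    (W₀ : WeierstrassCurve ℚ) [W₀.IsElliptic] (D₀ : ModularParametrizationData W₀ N) :
    ∃ (n : ℕ) (z₀ : ℂ), z₀ ∈ periodLattice D₀.f ∧ 1 ≤ n ∧ (n ≤ 10 ∨ n = 12) ∧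
      (∀ z ∈ periodLattice D₀.f, ∃ (k : ℤ) (w : ℂ), w ∈ periodLatticeGamma1 D₀.f ∧ z = (k : ℂ) * z₀ + w) ∧
      ∀ k : ℕ, (k : ℂ) * z₀ ∈ periodLatticeGamma1 D₀.f ↔ n ∣ k := by
  obtain ⟨W₁, hW₁, D₁, -, -, -, hL, z₀, P, hz₀, hP, -, hgen, hord, -⟩ := exists_ratPoint_generator_of_modularity hnf W₀ D₀
  obtain ⟨h1, h2⟩ := addOrderOf_mazurOrder_of_mazurShape (hMT (W₁.baseChange ℚ)) P (isOfFinAddOrder_of_baseChange_eq D₁ hL hz₀ hP)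
  exact ⟨addOrderOf P, z₀, hz₀, h1, h2, hgen, hord⟩

/-- **`[Λ₀(f) : Λ₁(f)] ∈ {1,…,10,12}` (⟸ {`mazur_torsion`, modularity})** — the Shimura index of every elliptic newform with an
`X₀(N)`-datum is a Mazur order. [cite: Mazur1977, Thm. (8)] -/
theorem relIndex_mazurOrder_of_modularity (hnf : exists_isNewformOf) (hMT : ∀ V : WeierstrassCurve ℚ, mazur_torsion V)
    (W₀ : WeierstrassCurve ℚ) [W₀.IsElliptic] (D₀ : ModularParametrizationData W₀ N) :
    1 ≤ (periodLatticeGamma1 D₀.f).relIndex (periodLattice D₀.f) ∧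
      ((periodLatticeGamma1 D₀.f).relIndex (periodLattice D₀.f) ≤ 10 ∨ (periodLatticeGamma1 D₀.f).relIndex (periodLattice D₀.f) = 12) := by
  obtain ⟨n, z₀, hz₀, h1, h2, hgen, hord⟩ := exists_generator_mazurOrder_of_modularity hnf hMT W₀ D₀
  rw [relIndex_eq_of_generator hz₀ hgen hord]
  exact ⟨h1, h2⟩

end Summit.BirchSwinnertonDyer.BirchSwinnertonDyer.Theorems.ManinLocalTwoThree.StevensCurve

end
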